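import Summits.QuantumFields.BalabanUV.Beta.GAN24.WilsonQuarticChargeOffDiag

/-!
# `BalabanUV.Beta.GAN24.ChargeStepSymD1` — binder row G-an2-4 / (CONV-C), W-slot road «W3» (SKELETON-W3 v1.0.2 §8.3 ∕ §8.5 (N-F4d); typer
# `LEAVES.md` v3.13 § IV-C ROW W3-F4d; GAPS § G-gan24ref1-30-1; ref2 R61-2), sequel of `ChargeStepSym` (leaf-18 gen 18): **THE FIELD–FIELD CHARGE OF
# THE SECOND DIFFERENCE `D♮₁ = T♮₂ − T♮₁` OF an2's NORMALISED STAGE-B FAMILY — the kernel input of the re-cut (R1) «unroll the difference tower from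
# `D₁`»: at the EXACT pin the charge vanishes FOR EVERY TABLE `Tc` (no bond symmetry needed), and at an3's colour-traced `w22 N` it vanishes
# IF AND ONLY IF the pin is exact**

NOT IN PRINT; OUR OBSERVATION + [folklore] algebra over tree theorems (G-an2-4 formalisation swarm, leaf prover `b2b-balaban-gan24-formalise-leaf-18`,
gen 18; module name PROVISIONAL — the row owner gan24-p1 ∕ the F4d holder lineage leaf-07 may rename ∕ re-home it).  HONEST FRAMING (cell contract,
verbatim): «discharging `BetaPertH` makes Bałaban's UV stability UNCONDITIONAL — a real constructive-QFT result; it is NOT the continuum limit and NOT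
the Clay problem.»  HONEST DEPENDENCY (verbatim): «continuum YM on T⁴ ⇐ BetaPertH ∧ nine spine estimates (0/9 proved); BetaPertH ⇐ (D1) ∧ (D4) ∧
CAP+tail; G-an2-4 gates asym, D1 and NE2/3/4.»

CONTEXT.  END #2 of road «W3» (`WSlotT2OfPieces.rate_of_rows` ∕ `t2Drift_of_rows`) unrolls the tower of one-step differences
`D♮_n = T♮_{n+1} − T♮_n` of the normalised family `T♮_j := unitS₂ (sfStep Lc j) (smStep d Lc j) (T2Of d Lc cE cVH cΛ cE₂ cB Tc (vh₂S d Lc) mixFF j)`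
from its member `D♮₀` and needs `hZ0 : Zfree (D♮₀)`.  `ChargeStepSym.zmode_succ_eq` (gen 17) showed that the linear part acts on the ff charge tensor by
`λ₀ · Sym_{bond}` — NOT by a scalar —, so `Z(D♮₀) = Z(b♮₀) + (λ₀·Sym − 1) Z(T♮₀)` keeps the bond-ANTISYMMETRIC part of the initial quartic charge
whatever the pin: at `Tc := w22 N` ROW W3-F2a (m = 0) and `hZ0` are jointly unsatisfiable (`WilsonQuarticChargeOffDiag.not_hZ0_of_hZb0_w22`, GAPS
§ G-gan24ref1-30-1).  Repair (R1) (journal l.9613 ∕ l.10060; ref2 R61-2 (b): «the re-cut of record») unrolls the difference tower from `D♮₁` instead: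
after ONE MORE transport the antisymmetric defect is gone (`Sym ∘ Asym = 0`).  THIS FILE is the charge side of (R1), as tree theorems:
* §0 `charge_factor_eq`: `Lc^{d+1}·K = ½·λ₀`, `K := (cE₂·Lc^{2(d+1)})·½·(Lc^{d+2})^{−4}` the prefactor of `zmode_succ_eq`, `λ₀ := cE₂·(Lc^{d+5})⁻¹`;
* §1 **`zmode_D1_eq`** — THE EXACT CHARGE OF `D♮₁` at any period `N` (four instances of `zmode_succ_eq`):
  `Z_N(D♮₁)(μ,ν) = Z_N(b♮₁)(μ,ν) − Z_N(b♮₀)(μ,ν) + N^{d+1}·K·Sym Z_{Lc}(b♮₀)(μ,ν) + N^{d+1}·K·(2·Lc^{d+1}·K − 1)·Sym Z_{Lc}(T♮₀)(μ,ν)`,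
  `Sym Z(μ,ν) := Z(μ,ν) + Z(ν,μ)`; and **`zmode_D1_eq_of_hZb`** (period `Lc`, given ROW W3-F2a's cell zero modes at `m = 0, 1`):
  `Z(D♮₁)(μ,ν;α,β) = Lc^{d+1}·(½λ₀)·(λ₀ − 1)·cE₂·(Z₄(Tc)(μ,ν;α,β) + Z₄(Tc)(ν,μ;α,β))` — bond-SYMMETRISED quartic charge only;
* §2 **`hZ1_cell_of_pinEq`** (generic `d`, ANY `Tc`): F2a cell zero modes at `m = 0, 1` ∧ `cE₂ = Lc^{d+5}` ⟹ `zmode Lc D♮₁ κ κ′ ff = 0`;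
  **`hZ1_three`** ∕ **`hZ1_three_of_hZ`** (d = 3, `hpinEq : cE₂ = +(Lc:ℝ)^(2*(3+1))` — sign `+`, ref2 R55-3): the literal `hZ0` binder of
  `WSlotT2OfPieces.rate_of_rows` at `D 0 := D♮₁` in the `Zfree` OF RECORD (ref2 R57-2 (b): jointly `Lc`-covariant — `T2SlotCovariance.T2diff_translate`
  BY NAME — ∧ cell ff zero mode), i.e. the pin half of a re-indexed ROW W3-F4d′ under (w12);
* §3 THE NON-VACUITY CHECK ref2 R61-2 (c) asks for: **`pin_or_symZ4_eq_zero_of_hZ1`** (any `Tc`): F2a₀ ∧ F2a₁ ∧ hZ1 ⟹ `cE₂ = 0 ∨ cE₂ = Lc^{d+5} ∨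
  Sym Z₄(Tc)(μ,ν;α,β) = 0` for all labels; at `Tc := w22 Nc` the symmetrised charge has the entry `Sym Z₄(0,1;1,0) = 2Nc² + 0 ≠ 0`
  (`WilsonQuarticChargeOffDiag.tsum_wilsonW₂_w22_ff_cross` ∕ `_par` BY NAME), whence **`hZ1_iff_pinEq_w22`**: for `cE₂ ≠ 0`, hZ1 ⟺ `cE₂ = Lc^{d+5}` —
  the (R1) pin row IS RULINGS-14d's exact pin at the table of record, SATISFIABLE (contrast `not_hZ0_of_hZb0_w22`).
Asserts NO shape or rate of Bałaban's tables beyond an2's member-wise `T2Of_loc`; ROW W3-F2a is a HYPOTHESIS (cell form, `m = 0, 1`); discharges NOTHING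
of «T2Shape» ∕ «T2SupRate» ∕ «T2Drift» ∕ (hW, hWall); which `Tc` the (D1) identification uses is an2∕an3's call; 0 `def`, 0 cite, 0 `def … : Prop`,
0 sorry, 0 wall binders instantiated; NOT «W-slot closed», NEVER «G-an2-4 closed»; NOT (CONV-C); NOT BetaPertH, NOT continuum, NOT Clay.
-/

noncomputable section

open Finset
open scoped BigOperators
open Literature.MathematicalPhysics.QuantumFieldTheory
open Literature.MathematicalPhysics.QuantumFieldTheory.Balaban1983to89
open Literature.MathematicalPhysics.QuantumFieldTheory.Balaban1983to89.Beta
open ExpKernelCalculus (MKer shiftK)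
open OneStepResolventKernel (Fib)
open OneStepKernelFamily (KInvStep)
open StepJetData (mfNeg)
open BalabanCompositeJets (LocStencil₂)
open SecondOrderResponse (LocStencilFM W2SymOfK)
open BalabanStepJetsSucc (mmRead)
open BalabanStepW2 (K3OfK Spure M1 M2Of T2Of)
open AveragingMixedJetTables (vh₂S)
open PlaquetteVertex2Trace (w22)
open WilsonBiStencil (wilsonW₂)
open Summit.QuantumFields.BalabanUV.Beta.HessKerDressedUnits (unitK unitS)
open Summit.QuantumFields.BalabanUV.Beta.SecondOrderUnits (unitM unitS₂ unitM₂)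
open Summit.QuantumFields.BalabanUV.Beta.GAN24.CombesThomas (sfStep smStep)
open Summit.QuantumFields.BalabanUV.Beta.GAN24.BiStencilZeroMode (Tab zmode)
open Summit.QuantumFields.BalabanUV.Beta.GAN24.T2SlotCovariance (T2diff_translate)
open Summit.QuantumFields.BalabanUV.Beta.GAN24.WSlotFirstDiff (zmode_sub)
open Summit.QuantumFields.BalabanUV.Beta.GAN24.WSlotForcingZeroMode (shape_member)
open Summit.QuantumFields.BalabanUV.Beta.GAN24.ChargeStepSym (zmode_succ_eq zmode_member_zero)
open Summit.QuantumFields.BalabanUV.Beta.GAN24.WilsonQuarticChargeOffDiag (tsum_wilsonW₂_w22_ff_cross tsum_wilsonW₂_w22_ff_par)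

namespace Summit.QuantumFields.BalabanUV.Beta.GAN24.ChargeStepSymD1

variable {d Lc : ℕ} [NeZero Lc]

/-! ## §0 The step prefactor is half the zero-momentum eigenvalue -/

/-- [folklore] **`Lc^{d+1} · K = ½ · λ₀`**: the prefactor `K = (cE₂·Lc^{2(d+1)})·½·(Lc^{d+2})^{−4}` of `ChargeStepSym.zmode_succ_eq`, read at period
`N = Lc`, is half the zero-momentum eigenvalue `λ₀ = cE₂·Lc^{−(d+5)}` (exponent count `(d+1) + 2(d+1) − 4(d+2) = −(d+5)`; cf. leaf-12's
`FirstDiffSymCharge.pow_charge_factor`, same number). -/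
theorem charge_factor_eq (cE₂ : ℝ) :
    ((Lc : ℝ) ^ (d + 1)) * ((cE₂ * (Lc : ℝ) ^ (2 * (d + 1))) * ((1 / 2 : ℝ) * (((Lc : ℝ) ^ (d + 1 + 1))⁻¹) ^ 4)) = (1 / 2 : ℝ) * (cE₂ * (((Lc : ℝ) ^ (d + 5))⁻¹)) := by
  have hL : (Lc : ℝ) ≠ 0 := Nat.cast_ne_zero.mpr (NeZero.ne Lc)
  field_simp
  ring

/-! ## §1 THE EXACT CHARGE OF THE SECOND DIFFERENCE `D♮₁ = T♮₂ − T♮₁` -/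

/-- **THE CHARGE OF `D♮₁ = T♮₂ − T♮₁` AT ANY PERIOD `N`** [folklore; `ChargeStepSym.zmode_succ_eq` four times + leaf-07's `zmode_sub`]:
`Z_N(D♮₁)(μ,ν) = (Z_N(b♮₁)(μ,ν) − Z_N(b♮₀)(μ,ν)) + N^{d+1}·K·(Z_{Lc}(b♮₀)(μ,ν) + Z_{Lc}(b♮₀)(ν,μ)) + N^{d+1}·K·(2·Lc^{d+1}·K − 1)·(Z_{Lc}(T♮₀)(μ,ν) + Z_{Lc}(T♮₀)(ν,μ))`
with `K := (cE₂·Lc^{2(d+1)})·½·(Lc^{d+2})^{−4}` (`2·Lc^{d+1}·K = λ₀`, §0).  The bond-antisymmetric part of `Z(T♮₀)` — the obstruction to `hZ0` at `D♮₀`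
(`ChargeStepSym` §4) — has DISAPPEARED: the second transport symmetrises it away (`Sym ∘ Asym = 0`).  Hypotheses: `1 ≤ Lc`, the mixed-table binders
`hmix` (shape, ∃-form) and `hmixt` (covariance); every colour constant symbolic, generic `d`, any `Tc`. -/
theorem zmode_D1_eq (hLc : 1 ≤ Lc) (N : ℕ) (cE cVH cΛ cE₂ cB : ℝ) (Tc : Fin 4 → Fin 4 → Fin 4 → Fin 4 → ℝ)
    {mixFF : Tab d} (hmix : ∃ C δ : ℝ, 0 < δ ∧ LocStencilFM Lc mixFF C δ)
    (hmixt : ∀ (κ : Fin (d + 1)) (u : Fin (d + 1) → ℤ) (ρ : Fin (d + 1)) (w t : Fin (d + 1) → ℤ),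
      mixFF κ (u + (Lc : ℤ) • t) ρ (w + t) = shiftK (-((Lc : ℤ) • t)) (mixFF κ u ρ w))
    (μ ν α β : Fin (d + 1)) :
    zmode N (fun κ u κ' u' => unitS₂ (sfStep Lc 2) (smStep d Lc 2) (T2Of d Lc cE cVH cΛ cE₂ cB Tc (vh₂S d Lc) mixFF 2) κ u κ' u' - unitS₂ (sfStep Lc 1) (smStep d Lc 1) (T2Of d Lc cE cVH cΛ cE₂ cB Tc (vh₂S d Lc) mixFF 1) κ u κ' u') μ ν (Sum.inl α) (Sum.inl β)
      = (zmode N (fun κ u κ' u' => (cE₂ * (Lc : ℝ) ^ (2 * (d + 1))) • mmRead Lc (K3OfK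
            (unitK (sfStep Lc 1) (smStep d Lc 1) (KInvStep (d := d) Lc 1)) Lc (unitS (sfStep Lc 1) (smStep d Lc 1) (Spure d Lc cE cVH cΛ 1))
            (unitM (sfStep Lc 1) (smStep d Lc 1) (M1 d Lc cΛ 1)) (W2SymOfK (unitK (sfStep Lc 1) (smStep d Lc 1) (KInvStep (d := d) Lc 1)) Lc
            (unitS (sfStep Lc 1) (smStep d Lc 1) (Spure d Lc cE cVH cΛ 1)) (unitM (sfStep Lc 1) (smStep d Lc 1) (M1 d Lc cΛ 1)) 0
            (unitM₂ (sfStep Lc 1) (smStep d Lc 1) (M2Of d Lc mixFF 1))) κ u κ' u') + cB • mfNeg ((vh₂S d Lc) κ u κ' u')) μ ν (Sum.inl α) (Sum.inl β)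
          - zmode N (fun κ u κ' u' => (cE₂ * (Lc : ℝ) ^ (2 * (d + 1))) • mmRead Lc (K3OfK
            (unitK (sfStep Lc 0) (smStep d Lc 0) (KInvStep (d := d) Lc 0)) Lc (unitS (sfStep Lc 0) (smStep d Lc 0) (Spure d Lc cE cVH cΛ 0))
            (unitM (sfStep Lc 0) (smStep d Lc 0) (M1 d Lc cΛ 0)) (W2SymOfK (unitK (sfStep Lc 0) (smStep d Lc 0) (KInvStep (d := d) Lc 0)) Lc
            (unitS (sfStep Lc 0) (smStep d Lc 0) (Spure d Lc cE cVH cΛ 0)) (unitM (sfStep Lc 0) (smStep d Lc 0) (M1 d Lc cΛ 0)) 0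
            (unitM₂ (sfStep Lc 0) (smStep d Lc 0) (M2Of d Lc mixFF 0))) κ u κ' u') + cB • mfNeg ((vh₂S d Lc) κ u κ' u')) μ ν (Sum.inl α) (Sum.inl β))
        + ((N : ℝ) ^ (d + 1)) * (((cE₂ * (Lc : ℝ) ^ (2 * (d + 1))) * ((1 / 2 : ℝ) * (((Lc : ℝ) ^ (d + 1 + 1))⁻¹) ^ 4)) *
          (zmode Lc (fun κ u κ' u' => (cE₂ * (Lc : ℝ) ^ (2 * (d + 1))) • mmRead Lc (K3OfK
            (unitK (sfStep Lc 0) (smStep d Lc 0) (KInvStep (d := d) Lc 0)) Lc (unitS (sfStep Lc 0) (smStep d Lc 0) (Spure d Lc cE cVH cΛ 0))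
            (unitM (sfStep Lc 0) (smStep d Lc 0) (M1 d Lc cΛ 0)) (W2SymOfK (unitK (sfStep Lc 0) (smStep d Lc 0) (KInvStep (d := d) Lc 0)) Lc
            (unitS (sfStep Lc 0) (smStep d Lc 0) (Spure d Lc cE cVH cΛ 0)) (unitM (sfStep Lc 0) (smStep d Lc 0) (M1 d Lc cΛ 0)) 0
            (unitM₂ (sfStep Lc 0) (smStep d Lc 0) (M2Of d Lc mixFF 0))) κ u κ' u') + cB • mfNeg ((vh₂S d Lc) κ u κ' u')) μ ν (Sum.inl α) (Sum.inl β)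
            + zmode Lc (fun κ u κ' u' => (cE₂ * (Lc : ℝ) ^ (2 * (d + 1))) • mmRead Lc (K3OfK
            (unitK (sfStep Lc 0) (smStep d Lc 0) (KInvStep (d := d) Lc 0)) Lc (unitS (sfStep Lc 0) (smStep d Lc 0) (Spure d Lc cE cVH cΛ 0))
            (unitM (sfStep Lc 0) (smStep d Lc 0) (M1 d Lc cΛ 0)) (W2SymOfK (unitK (sfStep Lc 0) (smStep d Lc 0) (KInvStep (d := d) Lc 0)) Lc
            (unitS (sfStep Lc 0) (smStep d Lc 0) (Spure d Lc cE cVH cΛ 0)) (unitM (sfStep Lc 0) (smStep d Lc 0) (M1 d Lc cΛ 0)) 0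
            (unitM₂ (sfStep Lc 0) (smStep d Lc 0) (M2Of d Lc mixFF 0))) κ u κ' u') + cB • mfNeg ((vh₂S d Lc) κ u κ' u')) ν μ (Sum.inl α) (Sum.inl β)))
        + ((N : ℝ) ^ (d + 1)) * (((cE₂ * (Lc : ℝ) ^ (2 * (d + 1))) * ((1 / 2 : ℝ) * (((Lc : ℝ) ^ (d + 1 + 1))⁻¹) ^ 4)) * ((2 * (((Lc : ℝ) ^ (d + 1)) * ((cE₂ * (Lc : ℝ) ^ (2 * (d + 1))) * ((1 / 2 : ℝ) * (((Lc : ℝ) ^ (d + 1 + 1))⁻¹) ^ 4))) - 1) *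
          (zmode Lc (unitS₂ (sfStep Lc 0) (smStep d Lc 0) (T2Of d Lc cE cVH cΛ cE₂ cB Tc (vh₂S d Lc) mixFF 0)) μ ν (Sum.inl α) (Sum.inl β)
            + zmode Lc (unitS₂ (sfStep Lc 0) (smStep d Lc 0) (T2Of d Lc cE cVH cΛ cE₂ cB Tc (vh₂S d Lc) mixFF 0)) ν μ (Sum.inl α) (Sum.inl β)))) := by
  obtain ⟨C1, δ1, hδ1, h1⟩ := shape_member hLc cE cVH cΛ cE₂ cB Tc hmix 1
  obtain ⟨C2, δ2, hδ2, h2⟩ := shape_member hLc cE cVH cΛ cE₂ cB Tc hmix 2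
  have e2 : zmode N (unitS₂ (sfStep Lc 2) (smStep d Lc 2) (T2Of d Lc cE cVH cΛ cE₂ cB Tc (vh₂S d Lc) mixFF 2)) μ ν (Sum.inl α) (Sum.inl β)
      = zmode N (fun κ u κ' u' => (cE₂ * (Lc : ℝ) ^ (2 * (d + 1))) • mmRead Lc (K3OfK
            (unitK (sfStep Lc 1) (smStep d Lc 1) (KInvStep (d := d) Lc 1)) Lc (unitS (sfStep Lc 1) (smStep d Lc 1) (Spure d Lc cE cVH cΛ 1))
            (unitM (sfStep Lc 1) (smStep d Lc 1) (M1 d Lc cΛ 1)) (W2SymOfK (unitK (sfStep Lc 1) (smStep d Lc 1) (KInvStep (d := d) Lc 1)) Lc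
            (unitS (sfStep Lc 1) (smStep d Lc 1) (Spure d Lc cE cVH cΛ 1)) (unitM (sfStep Lc 1) (smStep d Lc 1) (M1 d Lc cΛ 1)) 0
            (unitM₂ (sfStep Lc 1) (smStep d Lc 1) (M2Of d Lc mixFF 1))) κ u κ' u') + cB • mfNeg ((vh₂S d Lc) κ u κ' u')) μ ν (Sum.inl α) (Sum.inl β)
        + ((N : ℝ) ^ (d + 1)) * (((cE₂ * (Lc : ℝ) ^ (2 * (d + 1))) * ((1 / 2 : ℝ) * (((Lc : ℝ) ^ (d + 1 + 1))⁻¹) ^ 4)) *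
          (zmode Lc (unitS₂ (sfStep Lc 1) (smStep d Lc 1) (T2Of d Lc cE cVH cΛ cE₂ cB Tc (vh₂S d Lc) mixFF 1)) μ ν (Sum.inl α) (Sum.inl β)
            + zmode Lc (unitS₂ (sfStep Lc 1) (smStep d Lc 1) (T2Of d Lc cE cVH cΛ cE₂ cB Tc (vh₂S d Lc) mixFF 1)) ν μ (Sum.inl α) (Sum.inl β))) :=
    zmode_succ_eq hLc N cE cVH cΛ cE₂ cB Tc hmix hmixt 1 μ ν α β
  have e1 : zmode N (unitS₂ (sfStep Lc 1) (smStep d Lc 1) (T2Of d Lc cE cVH cΛ cE₂ cB Tc (vh₂S d Lc) mixFF 1)) μ ν (Sum.inl α) (Sum.inl β)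
      = zmode N (fun κ u κ' u' => (cE₂ * (Lc : ℝ) ^ (2 * (d + 1))) • mmRead Lc (K3OfK
            (unitK (sfStep Lc 0) (smStep d Lc 0) (KInvStep (d := d) Lc 0)) Lc (unitS (sfStep Lc 0) (smStep d Lc 0) (Spure d Lc cE cVH cΛ 0))
            (unitM (sfStep Lc 0) (smStep d Lc 0) (M1 d Lc cΛ 0)) (W2SymOfK (unitK (sfStep Lc 0) (smStep d Lc 0) (KInvStep (d := d) Lc 0)) Lc
            (unitS (sfStep Lc 0) (smStep d Lc 0) (Spure d Lc cE cVH cΛ 0)) (unitM (sfStep Lc 0) (smStep d Lc 0) (M1 d Lc cΛ 0)) 0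
            (unitM₂ (sfStep Lc 0) (smStep d Lc 0) (M2Of d Lc mixFF 0))) κ u κ' u') + cB • mfNeg ((vh₂S d Lc) κ u κ' u')) μ ν (Sum.inl α) (Sum.inl β)
        + ((N : ℝ) ^ (d + 1)) * (((cE₂ * (Lc : ℝ) ^ (2 * (d + 1))) * ((1 / 2 : ℝ) * (((Lc : ℝ) ^ (d + 1 + 1))⁻¹) ^ 4)) *
          (zmode Lc (unitS₂ (sfStep Lc 0) (smStep d Lc 0) (T2Of d Lc cE cVH cΛ cE₂ cB Tc (vh₂S d Lc) mixFF 0)) μ ν (Sum.inl α) (Sum.inl β)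
            + zmode Lc (unitS₂ (sfStep Lc 0) (smStep d Lc 0) (T2Of d Lc cE cVH cΛ cE₂ cB Tc (vh₂S d Lc) mixFF 0)) ν μ (Sum.inl α) (Sum.inl β))) :=
    zmode_succ_eq hLc N cE cVH cΛ cE₂ cB Tc hmix hmixt 0 μ ν α β
  have f1 : zmode Lc (unitS₂ (sfStep Lc 1) (smStep d Lc 1) (T2Of d Lc cE cVH cΛ cE₂ cB Tc (vh₂S d Lc) mixFF 1)) μ ν (Sum.inl α) (Sum.inl β)
      = zmode Lc (fun κ u κ' u' => (cE₂ * (Lc : ℝ) ^ (2 * (d + 1))) • mmRead Lc (K3OfK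
            (unitK (sfStep Lc 0) (smStep d Lc 0) (KInvStep (d := d) Lc 0)) Lc (unitS (sfStep Lc 0) (smStep d Lc 0) (Spure d Lc cE cVH cΛ 0))
            (unitM (sfStep Lc 0) (smStep d Lc 0) (M1 d Lc cΛ 0)) (W2SymOfK (unitK (sfStep Lc 0) (smStep d Lc 0) (KInvStep (d := d) Lc 0)) Lc
            (unitS (sfStep Lc 0) (smStep d Lc 0) (Spure d Lc cE cVH cΛ 0)) (unitM (sfStep Lc 0) (smStep d Lc 0) (M1 d Lc cΛ 0)) 0
            (unitM₂ (sfStep Lc 0) (smStep d Lc 0) (M2Of d Lc mixFF 0))) κ u κ' u') + cB • mfNeg ((vh₂S d Lc) κ u κ' u')) μ ν (Sum.inl α) (Sum.inl β)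
        + (((Lc : ℕ) : ℝ) ^ (d + 1)) * (((cE₂ * (Lc : ℝ) ^ (2 * (d + 1))) * ((1 / 2 : ℝ) * (((Lc : ℝ) ^ (d + 1 + 1))⁻¹) ^ 4)) *
          (zmode Lc (unitS₂ (sfStep Lc 0) (smStep d Lc 0) (T2Of d Lc cE cVH cΛ cE₂ cB Tc (vh₂S d Lc) mixFF 0)) μ ν (Sum.inl α) (Sum.inl β)
            + zmode Lc (unitS₂ (sfStep Lc 0) (smStep d Lc 0) (T2Of d Lc cE cVH cΛ cE₂ cB Tc (vh₂S d Lc) mixFF 0)) ν μ (Sum.inl α) (Sum.inl β))) :=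
    zmode_succ_eq hLc Lc cE cVH cΛ cE₂ cB Tc hmix hmixt 0 μ ν α β
  have f1' : zmode Lc (unitS₂ (sfStep Lc 1) (smStep d Lc 1) (T2Of d Lc cE cVH cΛ cE₂ cB Tc (vh₂S d Lc) mixFF 1)) ν μ (Sum.inl α) (Sum.inl β)
      = zmode Lc (fun κ u κ' u' => (cE₂ * (Lc : ℝ) ^ (2 * (d + 1))) • mmRead Lc (K3OfK
            (unitK (sfStep Lc 0) (smStep d Lc 0) (KInvStep (d := d) Lc 0)) Lc (unitS (sfStep Lc 0) (smStep d Lc 0) (Spure d Lc cE cVH cΛ 0))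
            (unitM (sfStep Lc 0) (smStep d Lc 0) (M1 d Lc cΛ 0)) (W2SymOfK (unitK (sfStep Lc 0) (smStep d Lc 0) (KInvStep (d := d) Lc 0)) Lc
            (unitS (sfStep Lc 0) (smStep d Lc 0) (Spure d Lc cE cVH cΛ 0)) (unitM (sfStep Lc 0) (smStep d Lc 0) (M1 d Lc cΛ 0)) 0
            (unitM₂ (sfStep Lc 0) (smStep d Lc 0) (M2Of d Lc mixFF 0))) κ u κ' u') + cB • mfNeg ((vh₂S d Lc) κ u κ' u')) ν μ (Sum.inl α) (Sum.inl β)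
        + (((Lc : ℕ) : ℝ) ^ (d + 1)) * (((cE₂ * (Lc : ℝ) ^ (2 * (d + 1))) * ((1 / 2 : ℝ) * (((Lc : ℝ) ^ (d + 1 + 1))⁻¹) ^ 4)) *
          (zmode Lc (unitS₂ (sfStep Lc 0) (smStep d Lc 0) (T2Of d Lc cE cVH cΛ cE₂ cB Tc (vh₂S d Lc) mixFF 0)) ν μ (Sum.inl α) (Sum.inl β)
            + zmode Lc (unitS₂ (sfStep Lc 0) (smStep d Lc 0) (T2Of d Lc cE cVH cΛ cE₂ cB Tc (vh₂S d Lc) mixFF 0)) μ ν (Sum.inl α) (Sum.inl β))) :=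
    zmode_succ_eq hLc Lc cE cVH cΛ cE₂ cB Tc hmix hmixt 0 ν μ α β
  rw [zmode_sub (N := N) (h2.mono (min_le_right _ _)) (h1.mono (min_le_left _ _)) (lt_min hδ1 hδ2) μ ν (Sum.inl α) (Sum.inl β),
    e2, f1, f1', e1]
  ring

/-- **THE CHARGE OF `D♮₁` GIVEN ROW W3-F2a AT `m = 0, 1`** (cell form, period `Lc`) [folklore]: only the bond-SYMMETRISED quartic charge of an3's
table survives — `Z_{Lc}(D♮₁)(μ,ν;α,β) = Lc^{d+1}·(½λ₀·(λ₀ − 1)·cE₂)·(Z₄(Tc)(μ,ν;α,β) + Z₄(Tc)(ν,μ;α,β))`, `λ₀ = cE₂·(Lc^{d+5})⁻¹`,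
`Z₄(Tc)(μ,ν;α,β) := Σ'_{u′xz} wilsonW₂ d Tc μ 0 ν u′ x z (inl α) (inl β)` (§1 + `ChargeStepSym.zmode_member_zero` + §0's exponent count). -/
theorem zmode_D1_eq_of_hZb (hLc : 1 ≤ Lc) (cE cVH cΛ cE₂ cB : ℝ) (Tc : Fin 4 → Fin 4 → Fin 4 → Fin 4 → ℝ)
    {mixFF : Tab d} (hmix : ∃ C δ : ℝ, 0 < δ ∧ LocStencilFM Lc mixFF C δ)
    (hmixt : ∀ (κ : Fin (d + 1)) (u : Fin (d + 1) → ℤ) (ρ : Fin (d + 1)) (w t : Fin (d + 1) → ℤ),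
      mixFF κ (u + (Lc : ℤ) • t) ρ (w + t) = shiftK (-((Lc : ℤ) • t)) (mixFF κ u ρ w))
    (hZb0 : ∀ (κ κ' α β : Fin (d + 1)), zmode Lc (fun κ u κ' u' => (cE₂ * (Lc : ℝ) ^ (2 * (d + 1))) • mmRead Lc (K3OfK
            (unitK (sfStep Lc 0) (smStep d Lc 0) (KInvStep (d := d) Lc 0)) Lc (unitS (sfStep Lc 0) (smStep d Lc 0) (Spure d Lc cE cVH cΛ 0))
            (unitM (sfStep Lc 0) (smStep d Lc 0) (M1 d Lc cΛ 0)) (W2SymOfK (unitK (sfStep Lc 0) (smStep d Lc 0) (KInvStep (d := d) Lc 0)) Lc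
            (unitS (sfStep Lc 0) (smStep d Lc 0) (Spure d Lc cE cVH cΛ 0)) (unitM (sfStep Lc 0) (smStep d Lc 0) (M1 d Lc cΛ 0)) 0
            (unitM₂ (sfStep Lc 0) (smStep d Lc 0) (M2Of d Lc mixFF 0))) κ u κ' u') + cB • mfNeg ((vh₂S d Lc) κ u κ' u')) κ κ' (Sum.inl α) (Sum.inl β) = 0)
    (hZb1 : ∀ (κ κ' α β : Fin (d + 1)), zmode Lc (fun κ u κ' u' => (cE₂ * (Lc : ℝ) ^ (2 * (d + 1))) • mmRead Lc (K3OfK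
            (unitK (sfStep Lc 1) (smStep d Lc 1) (KInvStep (d := d) Lc 1)) Lc (unitS (sfStep Lc 1) (smStep d Lc 1) (Spure d Lc cE cVH cΛ 1))
            (unitM (sfStep Lc 1) (smStep d Lc 1) (M1 d Lc cΛ 1)) (W2SymOfK (unitK (sfStep Lc 1) (smStep d Lc 1) (KInvStep (d := d) Lc 1)) Lc
            (unitS (sfStep Lc 1) (smStep d Lc 1) (Spure d Lc cE cVH cΛ 1)) (unitM (sfStep Lc 1) (smStep d Lc 1) (M1 d Lc cΛ 1)) 0
            (unitM₂ (sfStep Lc 1) (smStep d Lc 1) (M2Of d Lc mixFF 1))) κ u κ' u') + cB • mfNeg ((vh₂S d Lc) κ u κ' u')) κ κ' (Sum.inl α) (Sum.inl β) = 0)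
    (μ ν α β : Fin (d + 1)) :
    zmode Lc (fun κ u κ' u' => unitS₂ (sfStep Lc 2) (smStep d Lc 2) (T2Of d Lc cE cVH cΛ cE₂ cB Tc (vh₂S d Lc) mixFF 2) κ u κ' u' - unitS₂ (sfStep Lc 1) (smStep d Lc 1) (T2Of d Lc cE cVH cΛ cE₂ cB Tc (vh₂S d Lc) mixFF 1) κ u κ' u') μ ν (Sum.inl α) (Sum.inl β)
      = ((Lc : ℝ) ^ (d + 1)) * (((1 / 2 : ℝ) * (cE₂ * (((Lc : ℝ) ^ (d + 5))⁻¹))) * ((cE₂ * (((Lc : ℝ) ^ (d + 5))⁻¹)) - 1) * cE₂) *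
        ((∑' u' : Fin (d + 1) → ℤ, ∑' x : Fin (d + 1) → ℤ, ∑' z : Fin (d + 1) → ℤ, wilsonW₂ d Tc μ 0 ν u' x z (Sum.inl α) (Sum.inl β)) + (∑' u' : Fin (d + 1) → ℤ, ∑' x : Fin (d + 1) → ℤ, ∑' z : Fin (d + 1) → ℤ, wilsonW₂ d Tc ν 0 μ u' x z (Sum.inl α) (Sum.inl β))) := by
  rw [zmode_D1_eq hLc Lc cE cVH cΛ cE₂ cB Tc hmix hmixt μ ν α β]
  simp only [hZb0, hZb1, sub_self, add_zero, mul_zero, zero_add]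
  rw [zmode_member_zero Lc cE cVH cΛ cE₂ cB Tc mixFF μ ν α β, zmode_member_zero Lc cE cVH cΛ cE₂ cB Tc mixFF ν μ α β]
  have hL : (Lc : ℝ) ≠ 0 := Nat.cast_ne_zero.mpr (NeZero.ne Lc)
  field_simp
  ring

/-! ## §2 (R1)'s PIN ROW: at the exact pin the charge of `D♮₁` vanishes — for EVERY table `Tc` -/

/-- **`hZ1` FROM THE EXACT PIN, ANY `Tc`** [our observation; folklore algebra]: if ROW W3-F2a holds at `m = 0, 1` (cell ff zero modes of the brackets
`b♮₀`, `b♮₁`, period `Lc`) and the pin is exact, `cE₂ = Lc^{d+5}` (so `λ₀ = 1`), then the second difference `D♮₁ = T♮₂ − T♮₁` is field–field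
zero-mode-free: `zmode Lc D♮₁ κ κ′ (inl α) (inl β) = 0` for all labels.  NO bond symmetry of `Tc` is needed (contrast `ChargeStepSym` §4 for `D♮₀`). -/
theorem hZ1_cell_of_pinEq (hLc : 1 ≤ Lc) (cE cVH cΛ cE₂ cB : ℝ) (Tc : Fin 4 → Fin 4 → Fin 4 → Fin 4 → ℝ)
    {mixFF : Tab d} (hmix : ∃ C δ : ℝ, 0 < δ ∧ LocStencilFM Lc mixFF C δ)
    (hmixt : ∀ (κ : Fin (d + 1)) (u : Fin (d + 1) → ℤ) (ρ : Fin (d + 1)) (w t : Fin (d + 1) → ℤ),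
      mixFF κ (u + (Lc : ℤ) • t) ρ (w + t) = shiftK (-((Lc : ℤ) • t)) (mixFF κ u ρ w))
    (hpinEq : cE₂ = (Lc : ℝ) ^ (d + 5))
    (hZb0 : ∀ (κ κ' α β : Fin (d + 1)), zmode Lc (fun κ u κ' u' => (cE₂ * (Lc : ℝ) ^ (2 * (d + 1))) • mmRead Lc (K3OfK
            (unitK (sfStep Lc 0) (smStep d Lc 0) (KInvStep (d := d) Lc 0)) Lc (unitS (sfStep Lc 0) (smStep d Lc 0) (Spure d Lc cE cVH cΛ 0))
            (unitM (sfStep Lc 0) (smStep d Lc 0) (M1 d Lc cΛ 0)) (W2SymOfK (unitK (sfStep Lc 0) (smStep d Lc 0) (KInvStep (d := d) Lc 0)) Lc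
            (unitS (sfStep Lc 0) (smStep d Lc 0) (Spure d Lc cE cVH cΛ 0)) (unitM (sfStep Lc 0) (smStep d Lc 0) (M1 d Lc cΛ 0)) 0
            (unitM₂ (sfStep Lc 0) (smStep d Lc 0) (M2Of d Lc mixFF 0))) κ u κ' u') + cB • mfNeg ((vh₂S d Lc) κ u κ' u')) κ κ' (Sum.inl α) (Sum.inl β) = 0)
    (hZb1 : ∀ (κ κ' α β : Fin (d + 1)), zmode Lc (fun κ u κ' u' => (cE₂ * (Lc : ℝ) ^ (2 * (d + 1))) • mmRead Lc (K3OfK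
            (unitK (sfStep Lc 1) (smStep d Lc 1) (KInvStep (d := d) Lc 1)) Lc (unitS (sfStep Lc 1) (smStep d Lc 1) (Spure d Lc cE cVH cΛ 1))
            (unitM (sfStep Lc 1) (smStep d Lc 1) (M1 d Lc cΛ 1)) (W2SymOfK (unitK (sfStep Lc 1) (smStep d Lc 1) (KInvStep (d := d) Lc 1)) Lc
            (unitS (sfStep Lc 1) (smStep d Lc 1) (Spure d Lc cE cVH cΛ 1)) (unitM (sfStep Lc 1) (smStep d Lc 1) (M1 d Lc cΛ 1)) 0
            (unitM₂ (sfStep Lc 1) (smStep d Lc 1) (M2Of d Lc mixFF 1))) κ u κ' u') + cB • mfNeg ((vh₂S d Lc) κ u κ' u')) κ κ' (Sum.inl α) (Sum.inl β) = 0)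
    (κ κ' α β : Fin (d + 1)) :
    zmode Lc (fun κ u κ' u' => unitS₂ (sfStep Lc 2) (smStep d Lc 2) (T2Of d Lc cE cVH cΛ cE₂ cB Tc (vh₂S d Lc) mixFF 2) κ u κ' u' - unitS₂ (sfStep Lc 1) (smStep d Lc 1) (T2Of d Lc cE cVH cΛ cE₂ cB Tc (vh₂S d Lc) mixFF 1) κ u κ' u') κ κ' (Sum.inl α) (Sum.inl β) = 0 := by
  rw [zmode_D1_eq_of_hZb hLc cE cVH cΛ cE₂ cB Tc hmix hmixt hZb0 hZb1 κ κ' α β]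
  have hL : (Lc : ℝ) ≠ 0 := Nat.cast_ne_zero.mpr (NeZero.ne Lc)
  have h1 : cE₂ * (((Lc : ℝ) ^ (d + 5))⁻¹) = 1 := by
    rw [hpinEq]; exact mul_inv_cancel₀ (pow_ne_zero _ hL)
  rw [h1]
  ring

section Three

/-- **(R1)'s PIN ROW AT d = 3 IN THE `Zfree` OF RECORD** [our observation; folklore composition]: under the EXACT pin `hpinEq : cE₂ = +(Lc:ℝ)^(2*(3+1))`
(RULINGS-14d (N-F4d), sign `+` per ref2 R55-3) and ROW W3-F2a's cell zero modes at `m = 0, 1`, the second difference `D♮₁ = T♮₂ − T♮₁` satisfies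
the END's `Zfree` in ref2 R57-2 (b)'s conjunction form: (jointly `Lc`-covariant — `T2SlotCovariance.T2diff_translate … 1` BY NAME) ∧ (cell ff zero
mode `= 0`).  This is LITERALLY the `hZ0` binder of `WSlotT2OfPieces.rate_of_rows` ∕ `TransportRows.rate_three_of_rows_F3b`'s currency at
`D 0 := D♮₁` — the re-indexed ROW W3-F4d′ of the (R1) re-cut (ref2 R61-2 (c), condition (w12)) — for EVERY table `Tc`. -/
theorem hZ1_three (hLc : 1 ≤ Lc) (cE cVH cΛ cE₂ cB : ℝ) (Tc : Fin 4 → Fin 4 → Fin 4 → Fin 4 → ℝ)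
    {mixFF : Tab 3} (hmix : ∃ C δ : ℝ, 0 < δ ∧ LocStencilFM Lc mixFF C δ)
    (hmixt : ∀ (κ : Fin (3 + 1)) (u : Fin (3 + 1) → ℤ) (ρ : Fin (3 + 1)) (w t : Fin (3 + 1) → ℤ),
      mixFF κ (u + (Lc : ℤ) • t) ρ (w + t) = shiftK (-((Lc : ℤ) • t)) (mixFF κ u ρ w))
    (hpinEq : cE₂ = (Lc : ℝ) ^ (2 * (3 + 1)))
    (hZb0 : ∀ (κ κ' α β : Fin (3 + 1)), zmode Lc (fun κ u κ' u' => (cE₂ * (Lc : ℝ) ^ (2 * (3 + 1))) • mmRead Lc (K3OfK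
            (unitK (sfStep Lc 0) (smStep 3 Lc 0) (KInvStep (d := 3) Lc 0)) Lc (unitS (sfStep Lc 0) (smStep 3 Lc 0) (Spure 3 Lc cE cVH cΛ 0))
            (unitM (sfStep Lc 0) (smStep 3 Lc 0) (M1 3 Lc cΛ 0)) (W2SymOfK (unitK (sfStep Lc 0) (smStep 3 Lc 0) (KInvStep (d := 3) Lc 0)) Lc
            (unitS (sfStep Lc 0) (smStep 3 Lc 0) (Spure 3 Lc cE cVH cΛ 0)) (unitM (sfStep Lc 0) (smStep 3 Lc 0) (M1 3 Lc cΛ 0)) 0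
            (unitM₂ (sfStep Lc 0) (smStep 3 Lc 0) (M2Of 3 Lc mixFF 0))) κ u κ' u') + cB • mfNeg ((vh₂S 3 Lc) κ u κ' u')) κ κ' (Sum.inl α) (Sum.inl β) = 0)
    (hZb1 : ∀ (κ κ' α β : Fin (3 + 1)), zmode Lc (fun κ u κ' u' => (cE₂ * (Lc : ℝ) ^ (2 * (3 + 1))) • mmRead Lc (K3OfK
            (unitK (sfStep Lc 1) (smStep 3 Lc 1) (KInvStep (d := 3) Lc 1)) Lc (unitS (sfStep Lc 1) (smStep 3 Lc 1) (Spure 3 Lc cE cVH cΛ 1))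
            (unitM (sfStep Lc 1) (smStep 3 Lc 1) (M1 3 Lc cΛ 1)) (W2SymOfK (unitK (sfStep Lc 1) (smStep 3 Lc 1) (KInvStep (d := 3) Lc 1)) Lc
            (unitS (sfStep Lc 1) (smStep 3 Lc 1) (Spure 3 Lc cE cVH cΛ 1)) (unitM (sfStep Lc 1) (smStep 3 Lc 1) (M1 3 Lc cΛ 1)) 0
            (unitM₂ (sfStep Lc 1) (smStep 3 Lc 1) (M2Of 3 Lc mixFF 1))) κ u κ' u') + cB • mfNeg ((vh₂S 3 Lc) κ u κ' u')) κ κ' (Sum.inl α) (Sum.inl β) = 0) :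
    (∀ (κ : Fin (3 + 1)) (u : Fin (3 + 1) → ℤ) (κ' : Fin (3 + 1)) (u' t : Fin (3 + 1) → ℤ),
        (fun κ u κ' u' => unitS₂ (sfStep Lc 2) (smStep 3 Lc 2) (T2Of 3 Lc cE cVH cΛ cE₂ cB Tc (vh₂S 3 Lc) mixFF 2) κ u κ' u' - unitS₂ (sfStep Lc 1) (smStep 3 Lc 1) (T2Of 3 Lc cE cVH cΛ cE₂ cB Tc (vh₂S 3 Lc) mixFF 1) κ u κ' u') κ (u + (Lc : ℤ) • t) κ' (u' + (Lc : ℤ) • t)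
          = shiftK (-((Lc : ℤ) • t)) ((fun κ u κ' u' => unitS₂ (sfStep Lc 2) (smStep 3 Lc 2) (T2Of 3 Lc cE cVH cΛ cE₂ cB Tc (vh₂S 3 Lc) mixFF 2) κ u κ' u' - unitS₂ (sfStep Lc 1) (smStep 3 Lc 1) (T2Of 3 Lc cE cVH cΛ cE₂ cB Tc (vh₂S 3 Lc) mixFF 1) κ u κ' u') κ u κ' u')) ∧
      (∀ (κ κ' κ₁ κ₂ : Fin (3 + 1)), zmode Lc (fun κ u κ' u' => unitS₂ (sfStep Lc 2) (smStep 3 Lc 2) (T2Of 3 Lc cE cVH cΛ cE₂ cB Tc (vh₂S 3 Lc) mixFF 2) κ u κ' u' - unitS₂ (sfStep Lc 1) (smStep 3 Lc 1) (T2Of 3 Lc cE cVH cΛ cE₂ cB Tc (vh₂S 3 Lc) mixFF 1) κ u κ' u') κ κ' (Sum.inl κ₁) (Sum.inl κ₂) = 0) :=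
  ⟨fun κ u κ' u' t => T2diff_translate hLc cE cVH cΛ cE₂ cB Tc hmixt 1 κ u κ' u' t,
    hZ1_cell_of_pinEq hLc cE cVH cΛ cE₂ cB Tc hmix hmixt (hpinEq.trans (by norm_num)) hZb0 hZb1⟩

/-- **THE SAME FED BY ROW W3-F2a IN ITS END FORM** `hZ : ∀ m, Zfree (b♮ m)` (ref2 R57-2 (b) conjunction at the §8.3 bracket, the hypothesis shape of
`WSlotForcingZeroModeW3.hZf_of_hZ_W3`): only the cell-zero-mode conjuncts at `m = 0, 1` are used. -/
theorem hZ1_three_of_hZ (hLc : 1 ≤ Lc) (cE cVH cΛ cE₂ cB : ℝ) (Tc : Fin 4 → Fin 4 → Fin 4 → Fin 4 → ℝ)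
    {mixFF : Tab 3} (hmix : ∃ C δ : ℝ, 0 < δ ∧ LocStencilFM Lc mixFF C δ)
    (hmixt : ∀ (κ : Fin (3 + 1)) (u : Fin (3 + 1) → ℤ) (ρ : Fin (3 + 1)) (w t : Fin (3 + 1) → ℤ),
      mixFF κ (u + (Lc : ℤ) • t) ρ (w + t) = shiftK (-((Lc : ℤ) • t)) (mixFF κ u ρ w))
    (hpinEq : cE₂ = (Lc : ℝ) ^ (2 * (3 + 1)))
    (hZ : ∀ m, (∀ (κ : Fin (3 + 1)) (u : Fin (3 + 1) → ℤ) (κ' : Fin (3 + 1)) (u' t : Fin (3 + 1) → ℤ),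
        (fun κ u κ' u' => (cE₂ * (Lc : ℝ) ^ (2 * (3 + 1))) • mmRead Lc (K3OfK
            (unitK (sfStep Lc m) (smStep 3 Lc m) (KInvStep (d := 3) Lc m)) Lc (unitS (sfStep Lc m) (smStep 3 Lc m) (Spure 3 Lc cE cVH cΛ m))
            (unitM (sfStep Lc m) (smStep 3 Lc m) (M1 3 Lc cΛ m)) (W2SymOfK (unitK (sfStep Lc m) (smStep 3 Lc m) (KInvStep (d := 3) Lc m)) Lc
            (unitS (sfStep Lc m) (smStep 3 Lc m) (Spure 3 Lc cE cVH cΛ m)) (unitM (sfStep Lc m) (smStep 3 Lc m) (M1 3 Lc cΛ m)) 0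
            (unitM₂ (sfStep Lc m) (smStep 3 Lc m) (M2Of 3 Lc mixFF m))) κ u κ' u') + cB • mfNeg ((vh₂S 3 Lc) κ u κ' u')) κ (u + (Lc : ℤ) • t) κ' (u' + (Lc : ℤ) • t)
          = shiftK (-((Lc : ℤ) • t)) ((fun κ u κ' u' => (cE₂ * (Lc : ℝ) ^ (2 * (3 + 1))) • mmRead Lc (K3OfK
            (unitK (sfStep Lc m) (smStep 3 Lc m) (KInvStep (d := 3) Lc m)) Lc (unitS (sfStep Lc m) (smStep 3 Lc m) (Spure 3 Lc cE cVH cΛ m))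
            (unitM (sfStep Lc m) (smStep 3 Lc m) (M1 3 Lc cΛ m)) (W2SymOfK (unitK (sfStep Lc m) (smStep 3 Lc m) (KInvStep (d := 3) Lc m)) Lc
            (unitS (sfStep Lc m) (smStep 3 Lc m) (Spure 3 Lc cE cVH cΛ m)) (unitM (sfStep Lc m) (smStep 3 Lc m) (M1 3 Lc cΛ m)) 0
            (unitM₂ (sfStep Lc m) (smStep 3 Lc m) (M2Of 3 Lc mixFF m))) κ u κ' u') + cB • mfNeg ((vh₂S 3 Lc) κ u κ' u')) κ u κ' u')) ∧
      (∀ (κ κ' α β : Fin (3 + 1)), zmode Lc (fun κ u κ' u' => (cE₂ * (Lc : ℝ) ^ (2 * (3 + 1))) • mmRead Lc (K3OfK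
            (unitK (sfStep Lc m) (smStep 3 Lc m) (KInvStep (d := 3) Lc m)) Lc (unitS (sfStep Lc m) (smStep 3 Lc m) (Spure 3 Lc cE cVH cΛ m))
            (unitM (sfStep Lc m) (smStep 3 Lc m) (M1 3 Lc cΛ m)) (W2SymOfK (unitK (sfStep Lc m) (smStep 3 Lc m) (KInvStep (d := 3) Lc m)) Lc
            (unitS (sfStep Lc m) (smStep 3 Lc m) (Spure 3 Lc cE cVH cΛ m)) (unitM (sfStep Lc m) (smStep 3 Lc m) (M1 3 Lc cΛ m)) 0
            (unitM₂ (sfStep Lc m) (smStep 3 Lc m) (M2Of 3 Lc mixFF m))) κ u κ' u') + cB • mfNeg ((vh₂S 3 Lc) κ u κ' u')) κ κ' (Sum.inl α) (Sum.inl β) = 0)) :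
    (∀ (κ : Fin (3 + 1)) (u : Fin (3 + 1) → ℤ) (κ' : Fin (3 + 1)) (u' t : Fin (3 + 1) → ℤ),
        (fun κ u κ' u' => unitS₂ (sfStep Lc 2) (smStep 3 Lc 2) (T2Of 3 Lc cE cVH cΛ cE₂ cB Tc (vh₂S 3 Lc) mixFF 2) κ u κ' u' - unitS₂ (sfStep Lc 1) (smStep 3 Lc 1) (T2Of 3 Lc cE cVH cΛ cE₂ cB Tc (vh₂S 3 Lc) mixFF 1) κ u κ' u') κ (u + (Lc : ℤ) • t) κ' (u' + (Lc : ℤ) • t)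
          = shiftK (-((Lc : ℤ) • t)) ((fun κ u κ' u' => unitS₂ (sfStep Lc 2) (smStep 3 Lc 2) (T2Of 3 Lc cE cVH cΛ cE₂ cB Tc (vh₂S 3 Lc) mixFF 2) κ u κ' u' - unitS₂ (sfStep Lc 1) (smStep 3 Lc 1) (T2Of 3 Lc cE cVH cΛ cE₂ cB Tc (vh₂S 3 Lc) mixFF 1) κ u κ' u') κ u κ' u')) ∧
      (∀ (κ κ' κ₁ κ₂ : Fin (3 + 1)), zmode Lc (fun κ u κ' u' => unitS₂ (sfStep Lc 2) (smStep 3 Lc 2) (T2Of 3 Lc cE cVH cΛ cE₂ cB Tc (vh₂S 3 Lc) mixFF 2) κ u κ' u' - unitS₂ (sfStep Lc 1) (smStep 3 Lc 1) (T2Of 3 Lc cE cVH cΛ cE₂ cB Tc (vh₂S 3 Lc) mixFF 1) κ u κ' u') κ κ' (Sum.inl κ₁) (Sum.inl κ₂) = 0) :=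
  hZ1_three hLc cE cVH cΛ cE₂ cB Tc hmix hmixt hpinEq (hZ 0).2 (hZ 1).2

end Three

/-! ## §3 NON-VACUITY (ref2 R61-2 (c)): `hZ1` forces the exact pin unless the SYMMETRISED quartic charge vanishes; at `w22 N` it is the pin -/

/-- **`hZ1` ∧ ROW W3-F2a (m = 0, 1) ⟹ EXACT PIN, OR `cE₂ = 0`, OR A VANISHING SYMMETRISED QUARTIC CHARGE** [our observation; folklore algebra], any
`Tc`, cell forms at period `Lc`: from §1 `Lc^{d+1}·(½λ₀·(λ₀ − 1)·cE₂)·Sym Z₄(Tc)(μ,ν;α,β) = 0`, so for every label quadruple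
`cE₂ = 0 ∨ cE₂ = Lc^{d+5} ∨ Z₄(Tc)(μ,ν;α,β) + Z₄(Tc)(ν,μ;α,β) = 0`.  (Compare `ChargeStepSym.quartic_charge_bond_symm_of_hZ0_of_hZb0` for `D♮₀`:
there the ANTISYMMETRISED charge had to vanish WHATEVER the pin.) -/
theorem pin_or_symZ4_eq_zero_of_hZ1 (hLc : 1 ≤ Lc) (cE cVH cΛ cE₂ cB : ℝ) (Tc : Fin 4 → Fin 4 → Fin 4 → Fin 4 → ℝ)
    {mixFF : Tab d} (hmix : ∃ C δ : ℝ, 0 < δ ∧ LocStencilFM Lc mixFF C δ)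
    (hmixt : ∀ (κ : Fin (d + 1)) (u : Fin (d + 1) → ℤ) (ρ : Fin (d + 1)) (w t : Fin (d + 1) → ℤ),
      mixFF κ (u + (Lc : ℤ) • t) ρ (w + t) = shiftK (-((Lc : ℤ) • t)) (mixFF κ u ρ w))
    (hZb0 : ∀ (κ κ' α β : Fin (d + 1)), zmode Lc (fun κ u κ' u' => (cE₂ * (Lc : ℝ) ^ (2 * (d + 1))) • mmRead Lc (K3OfK
            (unitK (sfStep Lc 0) (smStep d Lc 0) (KInvStep (d := d) Lc 0)) Lc (unitS (sfStep Lc 0) (smStep d Lc 0) (Spure d Lc cE cVH cΛ 0))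
            (unitM (sfStep Lc 0) (smStep d Lc 0) (M1 d Lc cΛ 0)) (W2SymOfK (unitK (sfStep Lc 0) (smStep d Lc 0) (KInvStep (d := d) Lc 0)) Lc
            (unitS (sfStep Lc 0) (smStep d Lc 0) (Spure d Lc cE cVH cΛ 0)) (unitM (sfStep Lc 0) (smStep d Lc 0) (M1 d Lc cΛ 0)) 0
            (unitM₂ (sfStep Lc 0) (smStep d Lc 0) (M2Of d Lc mixFF 0))) κ u κ' u') + cB • mfNeg ((vh₂S d Lc) κ u κ' u')) κ κ' (Sum.inl α) (Sum.inl β) = 0)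
    (hZb1 : ∀ (κ κ' α β : Fin (d + 1)), zmode Lc (fun κ u κ' u' => (cE₂ * (Lc : ℝ) ^ (2 * (d + 1))) • mmRead Lc (K3OfK
            (unitK (sfStep Lc 1) (smStep d Lc 1) (KInvStep (d := d) Lc 1)) Lc (unitS (sfStep Lc 1) (smStep d Lc 1) (Spure d Lc cE cVH cΛ 1))
            (unitM (sfStep Lc 1) (smStep d Lc 1) (M1 d Lc cΛ 1)) (W2SymOfK (unitK (sfStep Lc 1) (smStep d Lc 1) (KInvStep (d := d) Lc 1)) Lc
            (unitS (sfStep Lc 1) (smStep d Lc 1) (Spure d Lc cE cVH cΛ 1)) (unitM (sfStep Lc 1) (smStep d Lc 1) (M1 d Lc cΛ 1)) 0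
            (unitM₂ (sfStep Lc 1) (smStep d Lc 1) (M2Of d Lc mixFF 1))) κ u κ' u') + cB • mfNeg ((vh₂S d Lc) κ u κ' u')) κ κ' (Sum.inl α) (Sum.inl β) = 0)
    (hZ1 : ∀ (κ κ' α β : Fin (d + 1)), zmode Lc (fun κ u κ' u' => unitS₂ (sfStep Lc 2) (smStep d Lc 2) (T2Of d Lc cE cVH cΛ cE₂ cB Tc (vh₂S d Lc) mixFF 2) κ u κ' u' - unitS₂ (sfStep Lc 1) (smStep d Lc 1) (T2Of d Lc cE cVH cΛ cE₂ cB Tc (vh₂S d Lc) mixFF 1) κ u κ' u') κ κ' (Sum.inl α) (Sum.inl β) = 0)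
    (μ ν α β : Fin (d + 1)) :
    cE₂ = 0 ∨ cE₂ = (Lc : ℝ) ^ (d + 5) ∨ (∑' u' : Fin (d + 1) → ℤ, ∑' x : Fin (d + 1) → ℤ, ∑' z : Fin (d + 1) → ℤ, wilsonW₂ d Tc μ 0 ν u' x z (Sum.inl α) (Sum.inl β)) + (∑' u' : Fin (d + 1) → ℤ, ∑' x : Fin (d + 1) → ℤ, ∑' z : Fin (d + 1) → ℤ, wilsonW₂ d Tc ν 0 μ u' x z (Sum.inl α) (Sum.inl β)) = 0 := by
  have h := zmode_D1_eq_of_hZb hLc cE cVH cΛ cE₂ cB Tc hmix hmixt hZb0 hZb1 μ ν α β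
  rw [hZ1 μ ν α β] at h
  have hL : (Lc : ℝ) ≠ 0 := Nat.cast_ne_zero.mpr (NeZero.ne Lc)
  have hL5 : ((Lc : ℝ) ^ (d + 5)) ≠ 0 := pow_ne_zero _ hL
  rcases mul_eq_zero.1 h.symm with hA | hS
  · rcases mul_eq_zero.1 hA with hL1 | hB
    · exact absurd hL1 (pow_ne_zero _ hL)
    · rcases mul_eq_zero.1 hB with hC | hE
      · rcases mul_eq_zero.1 hC with hlam | hlam1
        · -- `½·λ₀ = 0`
          left
          rcases mul_eq_zero.1 hlam with h2 | hlam0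
          · norm_num at h2
          · rcases mul_eq_zero.1 hlam0 with hc | hinv
            · exact hc
            · exact absurd (inv_eq_zero.1 hinv) hL5
        · -- `λ₀ − 1 = 0`
          right; left
          have hlam0 : cE₂ * (((Lc : ℝ) ^ (d + 5))⁻¹) = 1 := sub_eq_zero.1 hlam1
          calc cE₂ = cE₂ * ((((Lc : ℝ) ^ (d + 5))⁻¹) * ((Lc : ℝ) ^ (d + 5))) := by rw [inv_mul_cancel₀ hL5, mul_one]
            _ = (cE₂ * (((Lc : ℝ) ^ (d + 5))⁻¹)) * ((Lc : ℝ) ^ (d + 5)) := by ring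
            _ = (Lc : ℝ) ^ (d + 5) := by rw [hlam0, one_mul]
      · left; exact hE
  · right; right; exact hS

section W22

/-- **AT an3's COLOUR-TRACED TABLE THE (R1) PIN ROW IS EXACTLY THE PIN** [our observation]: at `Tc := w22 Nc` (`Nc ≠ 0`, `d ≥ 1`), for every colour weight
`cE₂ ≠ 0`, given ROW W3-F2a's cell zero modes at `m = 0, 1`: `(∀ κ κ′ α β, zmode Lc (T♮₂ − T♮₁) κ κ′ (inl α) (inl β) = 0) ↔ cE₂ = Lc^{d+5}`.
(`→`: §3 at the labels `(0,1;1,0)`, where the SYMMETRISED charge of `w22 Nc` is `2Nc² + 0 ≠ 0` — `WilsonQuarticChargeOffDiag.tsum_wilsonW₂_w22_ff_cross`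
∕ `_par` BY NAME; `←`: §2.)  So END #2 unrolled from `D♮₁` is SATISFIABLE at the table of record and pins `cE₂` exactly as RULINGS-14d designed —
contrast `WilsonQuarticChargeOffDiag.not_hZ0_of_hZb0_w22` for the unrolling from `D♮₀`. -/
theorem hZ1_iff_pinEq_w22 (hLc : 1 ≤ Lc) (hd : 1 ≤ d) {Nc : ℕ} (hNc : Nc ≠ 0) (cE cVH cΛ cE₂ cB : ℝ) (hcE₂ : cE₂ ≠ 0)
    {mixFF : Tab d} (hmix : ∃ C δ : ℝ, 0 < δ ∧ LocStencilFM Lc mixFF C δ)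
    (hmixt : ∀ (κ : Fin (d + 1)) (u : Fin (d + 1) → ℤ) (ρ : Fin (d + 1)) (w t : Fin (d + 1) → ℤ),
      mixFF κ (u + (Lc : ℤ) • t) ρ (w + t) = shiftK (-((Lc : ℤ) • t)) (mixFF κ u ρ w))
    (hZb0 : ∀ (κ κ' α β : Fin (d + 1)), zmode Lc (fun κ u κ' u' => (cE₂ * (Lc : ℝ) ^ (2 * (d + 1))) • mmRead Lc (K3OfK
            (unitK (sfStep Lc 0) (smStep d Lc 0) (KInvStep (d := d) Lc 0)) Lc (unitS (sfStep Lc 0) (smStep d Lc 0) (Spure d Lc cE cVH cΛ 0))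
            (unitM (sfStep Lc 0) (smStep d Lc 0) (M1 d Lc cΛ 0)) (W2SymOfK (unitK (sfStep Lc 0) (smStep d Lc 0) (KInvStep (d := d) Lc 0)) Lc
            (unitS (sfStep Lc 0) (smStep d Lc 0) (Spure d Lc cE cVH cΛ 0)) (unitM (sfStep Lc 0) (smStep d Lc 0) (M1 d Lc cΛ 0)) 0
            (unitM₂ (sfStep Lc 0) (smStep d Lc 0) (M2Of d Lc mixFF 0))) κ u κ' u') + cB • mfNeg ((vh₂S d Lc) κ u κ' u')) κ κ' (Sum.inl α) (Sum.inl β) = 0)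
    (hZb1 : ∀ (κ κ' α β : Fin (d + 1)), zmode Lc (fun κ u κ' u' => (cE₂ * (Lc : ℝ) ^ (2 * (d + 1))) • mmRead Lc (K3OfK
            (unitK (sfStep Lc 1) (smStep d Lc 1) (KInvStep (d := d) Lc 1)) Lc (unitS (sfStep Lc 1) (smStep d Lc 1) (Spure d Lc cE cVH cΛ 1))
            (unitM (sfStep Lc 1) (smStep d Lc 1) (M1 d Lc cΛ 1)) (W2SymOfK (unitK (sfStep Lc 1) (smStep d Lc 1) (KInvStep (d := d) Lc 1)) Lc
            (unitS (sfStep Lc 1) (smStep d Lc 1) (Spure d Lc cE cVH cΛ 1)) (unitM (sfStep Lc 1) (smStep d Lc 1) (M1 d Lc cΛ 1)) 0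
            (unitM₂ (sfStep Lc 1) (smStep d Lc 1) (M2Of d Lc mixFF 1))) κ u κ' u') + cB • mfNeg ((vh₂S d Lc) κ u κ' u')) κ κ' (Sum.inl α) (Sum.inl β) = 0) :
    (∀ (κ κ' α β : Fin (d + 1)), zmode Lc (fun κ u κ' u' => unitS₂ (sfStep Lc 2) (smStep d Lc 2) (T2Of d Lc cE cVH cΛ cE₂ cB (w22 Nc) (vh₂S d Lc) mixFF 2) κ u κ' u' - unitS₂ (sfStep Lc 1) (smStep d Lc 1) (T2Of d Lc cE cVH cΛ cE₂ cB (w22 Nc) (vh₂S d Lc) mixFF 1) κ u κ' u') κ κ' (Sum.inl α) (Sum.inl β) = 0)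
      ↔ cE₂ = (Lc : ℝ) ^ (d + 5) := by
  refine ⟨fun hZ1 => ?_, fun hpinEq => hZ1_cell_of_pinEq hLc cE cVH cΛ cE₂ cB (w22 Nc) hmix hmixt hpinEq hZb0 hZb1⟩
  have hne : (⟨0, by omega⟩ : Fin (d + 1)) ≠ ⟨1, by omega⟩ := by simp [Fin.ext_iff]
  rcases pin_or_symZ4_eq_zero_of_hZ1 hLc cE cVH cΛ cE₂ cB (w22 Nc) hmix hmixt hZb0 hZb1 hZ1
      ⟨0, by omega⟩ ⟨1, by omega⟩ ⟨1, by omega⟩ ⟨0, by omega⟩ with h0 | hpin | hS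
  · exact absurd h0 hcE₂
  · exact hpin
  · rw [tsum_wilsonW₂_w22_ff_cross Nc hne 0, tsum_wilsonW₂_w22_ff_par Nc hne.symm 0, add_zero] at hS
    exact absurd hS (mul_ne_zero two_ne_zero (pow_ne_zero 2 (Nat.cast_ne_zero.mpr hNc)))

end W22

end Summit.QuantumFields.BalabanUV.Beta.GAN24.ChargeStepSymD1

end
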